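/-
Copyright (c) 2026 the pub-hodgecm-mathlib formalisation cell (harness21).  Prover seat hodgecm-mathlib-K2E3-p23 (g4), Track B «K2-LIT» ∕ h413
(`stmt-HodgeConjecture-24833`), line `K2_E3_EllipticInputs`, (SC-an) road «FC» (line lead K2E3-p14 (g4), RULINGS #15∕#18), brick (FC-8) file F2.  2026-09-04.
-/
import Summits.HodgeConjecture.HodgeConjecture.Theorems.K2E3ConjFibreInfinite      -- ★ (FC-A) p857136 `lintegral_conj_eq_top_of_not_isCompact_centralizer`
import Literature.NumberTheory.Automorphic.UnitaryGroupAutomorphicRep             -- ★ `unitaryGroupOfForm`, `mem_unitaryGroupOfForm_iff`, `StdForm`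
import Mathlib.MeasureTheory.Group.Measure
import Mathlib.LinearAlgebra.Matrix.Determinant.Basic
import HarnessLib

/-!
# Crux `H413` — K2-LIT E3, (SC-an) road «FC» (finite conjugation measure), brick (FC-8) file F2: THE FIBRE REDUCTION — for `x ∈ K₀ t K₀`,
# `μ(A ∩ {g | x g x⁻¹ ∈ S}) ≤ μ(Ω ∩ {h | t h t⁻¹ ∈ Ω} ∩ P)` for any conjugation-invariant `P` containing the fibre; `P = {Z(·) compact}` via ★ (FC-A);
# and the diagonal LOWER bound `|hᵢᵢ| ≥ q^{−2M}` for a near-upper-triangular unitary `h`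

Cell `hodgecm-mathlib`, Track B, line `K2_E3_EllipticInputs`, socket U12 :255 (SC-an) via road «FC» of K2E3-p14 (g4) (RULINGS #15 (R15-1) steps (ii)–(iii), #18 (R18-1));
seat K2E3-p23 (g4).  THEOREMS ONLY (no `def`, no `instance`, no notation, no named-fact hypothesis, no `sorry`); count-neutral helper
(`--supports stmt-HodgeConjecture-24833 --as helper`).  Second of three files of (FC-8).

THE MATHEMATICS.
* §1 (generic group, `μ` left AND right invariant, measurable multiplication) `measure_conjPreimage_eq` — **`μ{g | y g y⁻¹ ∈ E} = μ(E)` for EVERY set `E`**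
  (conjugation is a measurable equivalence preserving `μ`; `MeasurableEquiv.map_apply` is valid for all sets).
* §2 `measure_inter_conjPreimage_le_of_invariant` — **THE REDUCTION**: `K ≤ G`, `x = k₀ t k₁ ∈ K t K`, `Ω` `K`-bi-invariant with `A, S ⊆ Ω`, `P` conjugation-invariant
  with `A ∩ {g | x g x⁻¹ ∈ S} ⊆ P` ⟹ `μ(A ∩ {g | x g x⁻¹ ∈ S}) ≤ μ(Ω ∩ {h | t h t⁻¹ ∈ Ω} ∩ P)` (`h = k₁ g k₁⁻¹`; K2E3-p11 (g4)'s ★ FC-B glue with the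
  predicate `P` threaded through).
* §3 `isCompact_centralizer_conj_iff` — `Z(y g y⁻¹) = y Z(g) y⁻¹`, so «compact centraliser» is conjugation-invariant;
  `isCompact_centralizer_of_lintegral_conj_lt_top` — ★ (FC-A) contraposed: **`∫ β(x g x⁻¹) dμ(x) < ⊤` and `β(x₀ g x₀⁻¹) ≠ 0` ⇒ `Z(g)` compact**;
  `fibre_subset_compactCentralizer` — hence `(C ∩ Φ_β) ∩ {g | x g x⁻¹ ∈ {β ≠ 0}} ⊆ Zc := {g | Z(g) compact}`.
* §4 (the model `U(σ, Φ₃)(K)`) `v_det_coe_eq_one` (`|det h| = 1`) and **`exp_neg_le_v_diag_of_upper_small`** — if `v(hᵢⱼ) ≤ exp M` for all entries, the upper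
  entries satisfy `v(h₀₁), v(h₁₂) ≤ exp(M − n)`, `v(h₀₂) ≤ exp(M − 2n)` and `3M < n`, then `v(h₀₀ h₁₁ h₂₂) = 1` and **`exp(−2M) ≤ v(hᵢᵢ)`** (every off-identity
  term of `det h` carries an upper entry, so `|det h − h₀₀h₁₁h₂₂| < 1 = |det h|`); `v_pow_mul_inv_diag_le_one` — the same as `v(ϖ^{2M} · hᵢᵢ⁻¹) ≤ 1`
  (the shape of (FC-5)'s `Valued.v (ϖ^M * x⁻¹) ≤ 1` binders, with `2M` for `M`).

HONEST LABEL: HC_CM is proved only modulo the 7 printed citations (2 remaining named inputs: hLiu418 = stmt-HodgeConjecture-24832, h413 =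
stmt-HodgeConjecture-24833) until rung 0 closes; elementary, closes no organ by itself ((SC-an) is NOT ★; road «FC» pays `hballE` only when all its bricks land).

## References
* [Folland1995] G. B. Folland, *A Course in Abstract Harmonic Analysis* (1995), §2.2, §2.4 (invariance of Haar measure; unimodular groups).
* [HarishChandra1970] Harish-Chandra (notes by G. van Dijk), *Harmonic Analysis on Reductive p-adic Groups*, LNM 162 (1970), Part V §3, Part VI §8 (the fibre
  integrals over `G∕Z(γ)` and their reduction along `K A K`).
* [Rogawski1990] J. D. Rogawski, *Automorphic Representations of Unitary Groups in Three Variables*, Ann. of Math. Stud. 123 (1990), §1.9 p. 8 (`det` on `U(Φ)`).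
* [Serre1979] J.-P. Serre, *Local Fields*, GTM 67 (1979), Ch. I §1, Ch. II §1 (the ultrametric inequality).
-/

set_option autoImplicit false
-- the mandated namespace repeats `HodgeConjecture.HodgeConjecture`, as in every `Theorems/*.lean` of this sub-problem
set_option linter.dupNamespace false

noncomputable section

open MeasureTheory MeasureTheory.Measure Set
open scoped ENNReal Pointwise MatrixGroups WithZero Valued

namespace Summit.HodgeConjecture.HodgeConjecture.Cruxes.H413.K2E3FinConjFibreReduction

/-! ## §1 Conjugation invariance of a two-sided invariant measure, on all sets -/

section Generic

variable {G : Type*} [Group G] [MeasurableSpace G]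

/-- **`μ{g | y g y⁻¹ ∈ E} = μ(E)` for every set `E`** (`μ` left and right invariant; conjugation by `y` is the measurable equivalence
`mulRight y⁻¹ ∘ mulLeft y`, and `map_apply` of a measurable equivalence holds for ALL sets). [cite: Folland1995, §2.4] -/
theorem measure_conjPreimage_eq [MeasurableMul G] (μ : Measure G) [μ.IsMulLeftInvariant] [μ.IsMulRightInvariant] (y : G) (E : Set G) :
    μ {g : G | y * g * y⁻¹ ∈ E} = μ E := by
  have hset : {g : G | y * g * y⁻¹ ∈ E} = (MeasurableEquiv.mulRight y⁻¹) ⁻¹' ((MeasurableEquiv.mulLeft y) ⁻¹' E) := by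
    ext g
    simp only [Set.mem_setOf_eq, Set.mem_preimage, MeasurableEquiv.coe_mulRight, MeasurableEquiv.coe_mulLeft, mul_assoc]
  calc μ {g : G | y * g * y⁻¹ ∈ E} = μ ((MeasurableEquiv.mulRight y⁻¹) ⁻¹' ((MeasurableEquiv.mulLeft y) ⁻¹' E)) := by rw [hset]
    _ = μ.map (MeasurableEquiv.mulRight y⁻¹) ((MeasurableEquiv.mulLeft y) ⁻¹' E) := (MeasurableEquiv.map_apply _ _).symm
    _ = μ ((MeasurableEquiv.mulLeft y) ⁻¹' E) := by rw [MeasurableEquiv.coe_mulRight, map_mul_right_eq_self]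
    _ = μ.map (MeasurableEquiv.mulLeft y) E := (MeasurableEquiv.map_apply _ _).symm
    _ = μ E := by rw [MeasurableEquiv.coe_mulLeft, map_mul_left_eq_self]

/-! ## §2 The reduction of the fibre count to the box, with a conjugation-invariant predicate -/

/-- **THE REDUCTION**: for `x ∈ K t K`, `Ω` `K`-bi-invariant containing `A` and `S`, and `P` conjugation-invariant containing the fibre `A ∩ {g | x g x⁻¹ ∈ S}`:
`μ(A ∩ {g | x g x⁻¹ ∈ S}) ≤ μ(Ω ∩ {h | t h t⁻¹ ∈ Ω} ∩ P)` — with `x = k₀ t k₁` the fibre is contained in `k₁⁻¹ (Ω ∩ {t · t⁻¹ ∈ Ω} ∩ P) k₁`, of the same measure.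
[cite: HarishChandra1970, Part V §3] [cite: Folland1995, §2.4] -/
theorem measure_inter_conjPreimage_le_of_invariant [MeasurableMul G] (μ : Measure G) [μ.IsMulLeftInvariant] [μ.IsMulRightInvariant]
    (K : Subgroup G) (t x : G) (hx : x ∈ (K : Set G) * {t} * (K : Set G)) (Ω : Set G)
    (hΩl : ∀ k ∈ K, ∀ g, k * g ∈ Ω ↔ g ∈ Ω) (hΩr : ∀ k ∈ K, ∀ g, g * k ∈ Ω ↔ g ∈ Ω)
    {A S P : Set G} (hA : A ⊆ Ω) (hS : S ⊆ Ω) (hP : ∀ y g, y * g * y⁻¹ ∈ P ↔ g ∈ P) (hASP : ∀ g ∈ A, x * g * x⁻¹ ∈ S → g ∈ P) :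
    μ (A ∩ {g : G | x * g * x⁻¹ ∈ S}) ≤ μ (Ω ∩ {h : G | t * h * t⁻¹ ∈ Ω} ∩ P) := by
  -- `x = k₀ t k₁`
  obtain ⟨x', hx', k₁, hk₁, hxe⟩ := Set.mem_mul.1 hx
  obtain ⟨k₀, hk₀, t', ht', hx'e⟩ := Set.mem_mul.1 hx'
  rw [Set.mem_singleton_iff] at ht'
  rw [ht'] at hx'e
  rw [← hx'e] at hxe
  subst hxe
  -- the fibre lies in the `k₁`-conjugate of the box
  have hsub : A ∩ {g : G | k₀ * t * k₁ * g * (k₀ * t * k₁)⁻¹ ∈ S} ⊆ {g : G | k₁ * g * k₁⁻¹ ∈ Ω ∩ {h : G | t * h * t⁻¹ ∈ Ω} ∩ P} := by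
    rintro g ⟨hgA, hgS⟩
    rw [Set.mem_setOf_eq] at hgS
    refine ⟨⟨?_, ?_⟩, (hP k₁ g).2 (hASP g hgA hgS)⟩
    · have h1 := (hΩl k₁ hk₁ _).2 ((hΩr k₁⁻¹ (K.inv_mem hk₁) g).2 (hA hgA))
      rwa [← mul_assoc] at h1
    · rw [Set.mem_setOf_eq]
      have h1 : t * (k₁ * g * k₁⁻¹) * t⁻¹ = k₀⁻¹ * (k₀ * t * k₁ * g * (k₀ * t * k₁)⁻¹) * k₀ := by group
      rw [h1, hΩr k₀ hk₀, hΩl k₀⁻¹ (K.inv_mem hk₀)]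
      exact hS hgS
  exact (measure_mono hsub).trans (le_of_eq (measure_conjPreimage_eq μ k₁ _))

end Generic

/-! ## §3 «Compact centraliser» is conjugation-invariant; ★ (FC-A) contraposed -/

section Centralizer

variable {G : Type*} [Group G] [TopologicalSpace G] [IsTopologicalGroup G]

omit [TopologicalSpace G] [IsTopologicalGroup G] in
/-- `Z(y g y⁻¹) = y Z(g) y⁻¹` as the image under conjugation. [folklore] -/
theorem coe_centralizer_conj_eq_image (y g : G) :
    ((Subgroup.centralizer ({y * g * y⁻¹} : Set G)) : Set G) = (fun z => y * z * y⁻¹) '' (Subgroup.centralizer ({g} : Set G)) := by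
  ext z
  simp only [SetLike.mem_coe, Subgroup.mem_centralizer_singleton_iff, Set.mem_image]
  constructor
  · intro h
    refine ⟨y⁻¹ * z * y, ?_, by group⟩
    calc y⁻¹ * z * y * g = y⁻¹ * (z * (y * g * y⁻¹)) * y := by group
      _ = y⁻¹ * (y * g * y⁻¹ * z) * y := by rw [h]
      _ = g * (y⁻¹ * z * y) := by group
  · rintro ⟨w, hw, rfl⟩
    calc y * w * y⁻¹ * (y * g * y⁻¹) = y * (w * g) * y⁻¹ := by group
      _ = y * (g * w) * y⁻¹ := by rw [hw]
      _ = y * g * y⁻¹ * (y * w * y⁻¹) := by group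

/-- If `Z(g)` is compact then so is `Z(y g y⁻¹)`. [folklore] -/
theorem isCompact_centralizer_conj {y g : G} (h : IsCompact ((Subgroup.centralizer ({g} : Set G)) : Set G)) :
    IsCompact ((Subgroup.centralizer ({y * g * y⁻¹} : Set G)) : Set G) := by
  rw [coe_centralizer_conj_eq_image]
  exact h.image ((continuous_const.mul continuous_id).mul continuous_const)

/-- **«Compact centraliser» is conjugation-invariant**: `Z(y g y⁻¹)` compact ↔ `Z(g)` compact. [folklore] -/
theorem isCompact_centralizer_conj_iff (y g : G) :
    IsCompact ((Subgroup.centralizer ({y * g * y⁻¹} : Set G)) : Set G) ↔ IsCompact ((Subgroup.centralizer ({g} : Set G)) : Set G) := by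
  refine ⟨fun h => ?_, fun h => isCompact_centralizer_conj h⟩
  have h' := isCompact_centralizer_conj (y := y⁻¹) h
  have hg : y⁻¹ * (y * g * y⁻¹) * y⁻¹⁻¹ = g := by group
  rwa [hg] at h'

variable [LocallyCompactSpace G] [T2Space G] [MeasurableSpace G] [BorelSpace G] (μ : Measure G) [μ.IsHaarMeasure] [μ.IsMulRightInvariant]

/-- **★ (FC-A) CONTRAPOSED**: if the conjugation fibre integral `∫ β(x g x⁻¹) dμ(x)` is finite and `β(x₀ g x₀⁻¹) ≠ 0` for a continuous `β ≥ 0`, then the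
centraliser `Z(g)` is compact. [cite: HarishChandra1970, Part V §3] -/
theorem isCompact_centralizer_of_lintegral_conj_lt_top {β : G → ℝ≥0∞} (hβ : Continuous β) {g x₀ : G}
    (hfin : ∫⁻ x, β (x * g * x⁻¹) ∂μ < ⊤) (hx₀ : β (x₀ * g * x₀⁻¹) ≠ 0) :
    IsCompact ((Subgroup.centralizer ({g} : Set G)) : Set G) := by
  by_contra hZ
  exact hfin.ne (K2E3ConjFibreInfinite.lintegral_conj_eq_top_of_not_isCompact_centralizer μ hβ hZ hx₀)

/-- **THE FIBRE LIES IN `Zc`**: for `A ⊆ Φ_β = {g | ∫ β(x g x⁻¹) dμ < ⊤}` and the open support `S = {β ≠ 0}`, every `g ∈ A` with `x g x⁻¹ ∈ S` has compact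
centraliser — the `hASP` input of `measure_inter_conjPreimage_le_of_invariant` with `P = {g | Z(g) compact}`. [cite: HarishChandra1970, Part V §3] -/
theorem fibre_subset_compactCentralizer {β : G → ℝ≥0∞} (hβ : Continuous β) {A : Set G} (hA : A ⊆ {g : G | ∫⁻ x, β (x * g * x⁻¹) ∂μ < ⊤}) (x : G) :
    ∀ g ∈ A, x * g * x⁻¹ ∈ {u : G | β u ≠ 0} → g ∈ {g : G | IsCompact ((Subgroup.centralizer ({g} : Set G)) : Set G)} :=
  fun _ hg hS => isCompact_centralizer_of_lintegral_conj_lt_top μ hβ (hA hg) hS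

omit [LocallyCompactSpace G] [T2Space G] [MeasurableSpace G] [BorelSpace G] in
/-- The conjugation-invariance of `Zc = {g | Z(g) compact}` in the shape of the `hP` input of `measure_inter_conjPreimage_le_of_invariant`. [folklore] -/
theorem conj_mem_compactCentralizer_iff (y g : G) :
    y * g * y⁻¹ ∈ {g : G | IsCompact ((Subgroup.centralizer ({g} : Set G)) : Set G)} ↔ g ∈ {g : G | IsCompact ((Subgroup.centralizer ({g} : Set G)) : Set G)} :=
  isCompact_centralizer_conj_iff y g

end Centralizer

/-! ## §4 The model `U(σ, Φ₃)(K)`: `|det| = 1` and the diagonal lower bound for a near-upper-triangular element -/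

section Model

open Literature.NumberTheory.Automorphic

variable {K : Type*} [Field K] [Valued K ℤᵐ⁰] (σ : K →+* K) {J : Matrix (Fin 3) (Fin 3) K} (hJ : J = (StdForm.antidiagonal 3).over K)

include hJ in
/-- **`|det h| = 1` on `U(σ, Φ₃)(K)`** for an isometric `σ`: `σ(det h) · det Φ₃ · det h = det Φ₃` and `det Φ₃ ≠ 0`. [cite: Rogawski1990, §1.9 p. 8] -/
theorem v_det_coe_eq_one (hσv : ∀ x, Valued.v (σ x) = Valued.v x) (h : ↥(unitaryGroupOfForm σ J)) :
    Valued.v ((h : GL (Fin 3) K) : Matrix (Fin 3) (Fin 3) K).det = 1 := by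
  have hJd : J.det ≠ 0 := by rw [hJ]; exact ((Matrix.isUnit_iff_isUnit_det _).1 ((StdForm.antidiagonal 3).isUnit_over _)).ne_zero
  have h0 := congrArg Matrix.det (mem_unitaryGroupOfForm_iff.1 h.2)
  rw [Matrix.det_mul, Matrix.det_mul, Matrix.det_transpose, ← RingHom.mapMatrix_apply, ← RingHom.map_det] at h0
  have h3 : σ ((h : GL (Fin 3) K) : Matrix (Fin 3) (Fin 3) K).det * ((h : GL (Fin 3) K) : Matrix (Fin 3) (Fin 3) K).det * J.det = 1 * J.det := by
    rw [mul_right_comm, one_mul]; exact h0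
  have h4 := congrArg Valued.v (mul_right_cancel₀ hJd h3)
  rw [map_mul, hσv, map_one, ← pow_two] at h4
  exact le_antisymm ((pow_le_one_iff two_ne_zero).1 h4.le) ((one_le_pow_iff two_ne_zero).1 h4.ge)

/-- Ultrametric bookkeeping: `a * b * c = 1`, `b, c ≤ exp M` ⇒ `exp(−2M) ≤ a` in `ℤᵐ⁰`. [folklore] -/
theorem exp_neg_two_mul_le_of_mul_mul_eq_one {a b c : ℤᵐ⁰} (h : a * b * c = 1) {M : ℕ} (hb : b ≤ WithZero.exp (M : ℤ)) (hc : c ≤ WithZero.exp (M : ℤ)) :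
    WithZero.exp (-(2 * (M : ℤ))) ≤ a := by
  have hbc0 : b * c ≠ 0 := by
    intro h0
    rw [mul_assoc, h0, mul_zero] at h
    exact zero_ne_one h
  have ha : a = (b * c)⁻¹ := eq_inv_of_mul_eq_one_left (by rwa [mul_assoc] at h)
  rw [ha, show (2 * (M : ℤ)) = (M : ℤ) + (M : ℤ) by ring, WithZero.exp_neg, WithZero.exp_add]
  exact inv_anti₀ (zero_lt_iff.2 hbc0) (mul_le_mul' hb hc)

include hJ in
/-- **THE DIAGONAL LOWER BOUND**: `h ∈ U(σ, Φ₃)(K)` with all entries `≤ exp M`, upper entries `v(h₀₁), v(h₁₂) ≤ exp(M − n)`, `v(h₀₂) ≤ exp(M − 2n)` and `3M < n`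
has `v(h₀₀) v(h₁₁) v(h₂₂) = 1` and hence **`exp(−2M) ≤ v(hᵢᵢ)`** for every `i` (every off-identity term of `det h` has valuation `≤ exp(3M − n) < 1 = v(det h)`).
[cite: Serre1979, Ch. II §1] [cite: HarishChandra1970, Part V §3] -/
theorem exp_neg_le_v_diag_of_upper_small (hσv : ∀ x, Valued.v (σ x) = Valued.v x) {M n : ℕ} (hn : 3 * M < n) (h : ↥(unitaryGroupOfForm σ J))
    (hall : ∀ i j, Valued.v (((h : GL (Fin 3) K) : Matrix (Fin 3) (Fin 3) K) i j) ≤ WithZero.exp (M : ℤ))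
    (h01 : Valued.v (((h : GL (Fin 3) K) : Matrix (Fin 3) (Fin 3) K) 0 1) ≤ WithZero.exp ((M : ℤ) - n))
    (h12 : Valued.v (((h : GL (Fin 3) K) : Matrix (Fin 3) (Fin 3) K) 1 2) ≤ WithZero.exp ((M : ℤ) - n))
    (h02 : Valued.v (((h : GL (Fin 3) K) : Matrix (Fin 3) (Fin 3) K) 0 2) ≤ WithZero.exp ((M : ℤ) - 2 * n)) (i : Fin 3) :
    WithZero.exp (-(2 * (M : ℤ))) ≤ Valued.v (((h : GL (Fin 3) K) : Matrix (Fin 3) (Fin 3) K) i i) := by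
  set A : Matrix (Fin 3) (Fin 3) K := ((h : GL (Fin 3) K) : Matrix (Fin 3) (Fin 3) K) with hA
  -- the off-identity part `R` of `det A` and its smallness
  set R : K := A 0 1 * A 1 2 * A 2 0 + A 0 2 * A 1 0 * A 2 1 + -(A 0 0 * A 1 2 * A 2 1) + -(A 0 1 * A 1 0 * A 2 2) + -(A 0 2 * A 1 1 * A 2 0) with hR
  have hdet : A.det = A 0 0 * A 1 1 * A 2 2 + R := by rw [Matrix.det_fin_three, hR]; ring
  have hMn : (3 * (M : ℤ) - n) < 0 := by omega
  have hMn2 : (3 * (M : ℤ) - 2 * n) < 0 := by omega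
  -- each of the five terms has valuation `< 1`
  have t1 : Valued.v (A 0 0 * A 1 2 * A 2 1) < 1 := by
    rw [map_mul, map_mul]
    calc Valued.v (A 0 0) * Valued.v (A 1 2) * Valued.v (A 2 1)
        ≤ WithZero.exp (M : ℤ) * WithZero.exp ((M : ℤ) - n) * WithZero.exp (M : ℤ) := mul_le_mul' (mul_le_mul' (hall 0 0) h12) (hall 2 1)
      _ = WithZero.exp (3 * (M : ℤ) - n) := by rw [← WithZero.exp_add, ← WithZero.exp_add]; ring_nf
      _ < 1 := by rw [← WithZero.exp_zero]; exact WithZero.exp_lt_exp.2 hMn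
  have t2 : Valued.v (A 0 1 * A 1 0 * A 2 2) < 1 := by
    rw [map_mul, map_mul]
    calc Valued.v (A 0 1) * Valued.v (A 1 0) * Valued.v (A 2 2)
        ≤ WithZero.exp ((M : ℤ) - n) * WithZero.exp (M : ℤ) * WithZero.exp (M : ℤ) := mul_le_mul' (mul_le_mul' h01 (hall 1 0)) (hall 2 2)
      _ = WithZero.exp (3 * (M : ℤ) - n) := by rw [← WithZero.exp_add, ← WithZero.exp_add]; ring_nf
      _ < 1 := by rw [← WithZero.exp_zero]; exact WithZero.exp_lt_exp.2 hMn
  have t3 : Valued.v (A 0 1 * A 1 2 * A 2 0) < 1 := by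
    rw [map_mul, map_mul]
    calc Valued.v (A 0 1) * Valued.v (A 1 2) * Valued.v (A 2 0)
        ≤ WithZero.exp ((M : ℤ) - n) * WithZero.exp ((M : ℤ) - n) * WithZero.exp (M : ℤ) := mul_le_mul' (mul_le_mul' h01 h12) (hall 2 0)
      _ = WithZero.exp (3 * (M : ℤ) - 2 * n) := by rw [← WithZero.exp_add, ← WithZero.exp_add]; ring_nf
      _ < 1 := by rw [← WithZero.exp_zero]; exact WithZero.exp_lt_exp.2 hMn2
  have t4 : Valued.v (A 0 2 * A 1 0 * A 2 1) < 1 := by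
    rw [map_mul, map_mul]
    calc Valued.v (A 0 2) * Valued.v (A 1 0) * Valued.v (A 2 1)
        ≤ WithZero.exp ((M : ℤ) - 2 * n) * WithZero.exp (M : ℤ) * WithZero.exp (M : ℤ) := mul_le_mul' (mul_le_mul' h02 (hall 1 0)) (hall 2 1)
      _ = WithZero.exp (3 * (M : ℤ) - 2 * n) := by rw [← WithZero.exp_add, ← WithZero.exp_add]; ring_nf
      _ < 1 := by rw [← WithZero.exp_zero]; exact WithZero.exp_lt_exp.2 hMn2
  have t5 : Valued.v (A 0 2 * A 1 1 * A 2 0) < 1 := by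
    rw [map_mul, map_mul]
    calc Valued.v (A 0 2) * Valued.v (A 1 1) * Valued.v (A 2 0)
        ≤ WithZero.exp ((M : ℤ) - 2 * n) * WithZero.exp (M : ℤ) * WithZero.exp (M : ℤ) := mul_le_mul' (mul_le_mul' h02 (hall 1 1)) (hall 2 0)
      _ = WithZero.exp (3 * (M : ℤ) - 2 * n) := by rw [← WithZero.exp_add, ← WithZero.exp_add]; ring_nf
      _ < 1 := by rw [← WithZero.exp_zero]; exact WithZero.exp_lt_exp.2 hMn2
  have hneg : ∀ x : K, Valued.v x < 1 → Valued.v (-x) < 1 := fun x hx => by rwa [Valuation.map_neg]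
  have hRlt : Valued.v R < 1 := by
    rw [hR]
    exact Valuation.map_add_lt _ (Valuation.map_add_lt _ (Valuation.map_add_lt _ (Valuation.map_add_lt _ t3 t4) (hneg _ t1)) (hneg _ t2)) (hneg _ t5)
  -- hence `v(h₀₀ h₁₁ h₂₂) = 1`
  have hdet1 : Valued.v A.det = 1 := v_det_coe_eq_one σ hJ hσv h
  have hP : Valued.v (A 0 0 * A 1 1 * A 2 2) = 1 := by
    have hPe : A 0 0 * A 1 1 * A 2 2 = A.det + -R := by rw [hdet]; ring
    rw [hPe, Valuation.map_add_eq_of_lt_left, hdet1]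
    rw [Valuation.map_neg, hdet1]; exact hRlt
  rw [map_mul, map_mul] at hP
  have hi : i = 0 ∨ i = 1 ∨ i = 2 := by decide +revert
  rcases hi with rfl | rfl | rfl
  · exact exp_neg_two_mul_le_of_mul_mul_eq_one hP (hall 1 1) (hall 2 2)
  · refine exp_neg_two_mul_le_of_mul_mul_eq_one (b := Valued.v (A 0 0)) (c := Valued.v (A 2 2)) ?_ (hall 0 0) (hall 2 2)
    rw [mul_comm (Valued.v (A 1 1)) (Valued.v (A 0 0))]; exact hP
  · refine exp_neg_two_mul_le_of_mul_mul_eq_one (b := Valued.v (A 0 0)) (c := Valued.v (A 1 1)) ?_ (hall 0 0) (hall 1 1)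
    rw [mul_rotate]; exact hP

include hJ in
/-- **The diagonal lower bound in the shape of (FC-5)'s binders**: under the hypotheses of `exp_neg_le_v_diag_of_upper_small` and `v(ϖ) = exp(−1)`,
`hᵢᵢ ≠ 0` and `v(ϖ^{2M} · hᵢᵢ⁻¹) ≤ 1`. [cite: Serre1979, Ch. II §1] -/
theorem v_pow_mul_inv_diag_le_one (hσv : ∀ x, Valued.v (σ x) = Valued.v x) {ϖ : K} (hϖ : Valued.v ϖ = WithZero.exp (-1 : ℤ)) {M n : ℕ} (hn : 3 * M < n)
    (h : ↥(unitaryGroupOfForm σ J))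
    (hall : ∀ i j, Valued.v (((h : GL (Fin 3) K) : Matrix (Fin 3) (Fin 3) K) i j) ≤ WithZero.exp (M : ℤ))
    (h01 : Valued.v (((h : GL (Fin 3) K) : Matrix (Fin 3) (Fin 3) K) 0 1) ≤ WithZero.exp ((M : ℤ) - n))
    (h12 : Valued.v (((h : GL (Fin 3) K) : Matrix (Fin 3) (Fin 3) K) 1 2) ≤ WithZero.exp ((M : ℤ) - n))
    (h02 : Valued.v (((h : GL (Fin 3) K) : Matrix (Fin 3) (Fin 3) K) 0 2) ≤ WithZero.exp ((M : ℤ) - 2 * n)) (i : Fin 3) :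
    ((h : GL (Fin 3) K) : Matrix (Fin 3) (Fin 3) K) i i ≠ 0 ∧
      Valued.v (ϖ ^ (2 * M) * (((h : GL (Fin 3) K) : Matrix (Fin 3) (Fin 3) K) i i)⁻¹) ≤ 1 := by
  have hlow := exp_neg_le_v_diag_of_upper_small σ hJ hσv hn h hall h01 h12 h02 i
  have hne : ((h : GL (Fin 3) K) : Matrix (Fin 3) (Fin 3) K) i i ≠ 0 := by
    intro h0
    rw [h0, map_zero] at hlow
    exact (lt_irrefl (0 : ℤᵐ⁰)) (lt_of_lt_of_le WithZero.exp_pos hlow)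
  refine ⟨hne, ?_⟩
  have hinv : (Valued.v (((h : GL (Fin 3) K) : Matrix (Fin 3) (Fin 3) K) i i))⁻¹ ≤ WithZero.exp (2 * (M : ℤ)) := by
    have := inv_anti₀ WithZero.exp_pos hlow
    rwa [← WithZero.exp_neg, neg_neg] at this
  have hpow : Valued.v (ϖ ^ (2 * M)) = WithZero.exp (-(2 * (M : ℤ))) := by
    rw [map_pow, hϖ, ← WithZero.exp_nsmul, nsmul_eq_mul]
    push_cast
    ring_nf
  rw [map_mul, map_inv₀, hpow]
  calc WithZero.exp (-(2 * (M : ℤ))) * (Valued.v (((h : GL (Fin 3) K) : Matrix (Fin 3) (Fin 3) K) i i))⁻¹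
      ≤ WithZero.exp (-(2 * (M : ℤ))) * WithZero.exp (2 * (M : ℤ)) := mul_le_mul' le_rfl hinv
    _ = 1 := by rw [← WithZero.exp_add, neg_add_cancel, WithZero.exp_zero]

end Model

end Summit.HodgeConjecture.HodgeConjecture.Cruxes.H413.K2E3FinConjFibreReduction

end
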